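import Literature.Computability.AlgebraicComplexity.ABV17SingularLocusBound
import Literature.Computability.AlgebraicComplexity.DeterminantalConormalBoundProofs
import Literature.LinearAlgebra.Matrix.AdjugateRank
import Literature.RingTheory.KrullDimension.GenericAvoidance
import Literature.RingTheory.MvPolynomial.HomogeneousDimension
import Mathlib.RingTheory.Nullstellensatz
import HarnessLib

/-!
# Alper–Bogart–Velasco 2017, Thm. 1.7 (Bertini): PROOF of the named fact
# `alperBogartVelasco2017_thm_1_7_general`

Topic `Literature/Computability/AlgebraicComplexity` (cell val-lit, row ABV2017-A); companion of
`ABV17SingularLocusBound.lean`, which types J. Alper, T. Bogart, M. Velasco, *A lower bound for the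
determinantal complexity of a hypersurface*, Found. Comput. Math. 17 (2017) 829–836 =
arXiv:1505.02205 (HELD as `paper:arxiv-1505.02205`; locators `pNNNN.txt:Lnn`). That file PROVES the
inequality of Thm. 1.7 (`alperBogartVelasco2017_thm_1_7_le`, p0003.txt:L62: "Then
`codim(Sing(f)) ≤ min(4, n)`") and leaves the equality clause ("and equality holds if `L` is a
general linear map", p0003.txt:L62; first bullet p0003.txt:L66: "if `n ≤ 4` then `𝕍(f)` is
nonsingular for a general linear map `L`") as the NAMED FACT
`alperBogartVelasco2017_thm_1_7_general`: over an algebraically closed field of characteristic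
`0`, for `m ≥ 2` and every `n` there is a non-zero polynomial `Φ` in the `m²n` coefficients
`c_{ijw}` of `L = (Σ_w c_{ijw} x_w)_{ij}` with `height (f, ∂f/∂x_w) = min(4, n)` whenever
`Φ(c) ≠ 0`, `f = det_m ∘ L`. This file DISCHARGES it:
`alperBogartVelasco2017_thm_1_7_general_holds` (theorems + auxiliary definitions only, no new
facts; D-0026). Honest framing: a classical Bertini statement about the singular locus of a
general determinantal linear section; VP ≠ VNP is NOT proved and nothing here is progress on it.

## AS PRINTED vs AS PROVED

The printed proof (p0005.txt:L43–L57) reduces to `L` injective, writes `𝕍(f) ⊆ ℙⁿ⁻¹` as the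
section of `𝕍(det_m) ⊆ ℙ^{m²-1}` by `m² - n` general hyperplanes and applies Bertini's theorem
(Harris, GTM 133, 17.16: "`Sing(H ∩ X) = H ∩ Sing(X)`, and `dim Sing(H ∩ X) = dim Sing(X) - 1`")
`m² - n` times, using `dim Sing 𝕍(det_m) = m² - 5`. The statement proved here is EXACTLY the typed
one; the argument is the same geometry organised as ONE dimension count — the proof of Bertini's
theorem in Hartshorne, *Algebraic Geometry*, II Thm. 8.18 ("the bad hyperplanes form a subset of
dimension `< dim` of the dual space") — which the tree provides in affine form as GENERIC AVOIDANCE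
(`Literature.RingTheory.KrullDimension.exists_ne_zero_forall_mem_of_isMaximal`,
`Literature/RingTheory/KrullDimension/GenericAvoidance.lean`). The hypothesis `char k = 0` of the
fact is not used (hyperplane-type Bertini statements hold in every characteristic); algebraic
closedness is used through the Nullstellensatz.

## Architecture

Write `Y_c(x) = Σ_w x_w C_w` (`pencil`), `C_w = (c_{ijw})_{ij}` (`coefMat`), `L_c` (`linMat`).

* Part 2 — **generic avoidance for LINEAR incidences over affine space**
  (`exists_ne_zero_forall_mulVec_ne_zero`): if a matrix `κ(t)` of polynomials in position
  coordinates `t ∈ k^τ` has rank `≥ #τ + 1` at every point, some `h ≠ 0` has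
  `h(a) ≠ 0 ⇒ κ(t) a ≠ 0` for all `t` (closed points of `k[τ]` are points — Mathlib's
  Nullstellensatz `MvPolynomial.eq_vanishingIdeal_singleton_of_isMaximal`; linear bad sets have
  `dim = #params - rank` — the tree's `ringKrullDim_quotient_linIdeal_add_le`).
* Part 3 — **singular points of the cone** (Jacobi, the tree's
  `DeterminantalConormal.eval_pderiv_det`): `x ∈ Sing(f_c)` iff `det Y = 0` and
  `tr(adj Y · C_w) = 0` for all `w`, `Y = Y_c(x)`; and then (`singular_point_cases`) either
  `adj Y = 0`, giving two kernel vectors in reduced echelon form (`rank adj = C(rank, m-1)`,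
  `Literature.LinearAlgebra.Matrix.rank_adjugate`), or `adj Y = v uᵀ` for a kernel pair with
  `uᵀ C_w v = 0` for all `w` (the tree's `DeterminantalConormal.exists_kernelPair_of_adjugate_ne_zero`).
* Part 4 — **rank-drop incidence (S)** over the charts `(w₀, j₁, j₂)` of `ℙⁿ⁻¹ × Gr(2, m)`
  (`x_{w₀} = 1`, kernel vectors with pivots `j₁ ≠ j₂`): the bad coefficients
  `{c | Y_c(x) v₁ = Y_c(x) v₂ = 0}` are the kernel of a SURJECTION onto `k^m × k^m`
  (`kapS_mulVec_surjective`), of codimension `2m ≥ (n-1) + 2(m-2) + 1` iff `n ≤ 4`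
  (`exists_generic_no_rankDrop`).
* Part 5 — **tangency incidence (T)** over the charts `(w₀, i₀, j₀)` of `ℙⁿ⁻¹ × ℙ^{m-1} × ℙ^{m-1}`:
  the bad coefficients `{c | Y v = 0, uᵀ Y = 0, uᵀ C_w v = 0 ∀ w}` surject onto
  `k^m × k^{j ≠ j₀} × k^{w ≠ w₀}` (`kapT_mulVec_surjective`), codimension
  `2m + n - 2 = (n-1) + (m-1) + (m-1) + 1` for EVERY `n` (`exists_generic_no_tangency`).
* Part 6 — for `n ≤ 4`, `Φ = Φ_S · Φ_T`: `Φ(c) ≠ 0 ⇒ Sing(f_c) = {0}`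
  (`exists_generic_sing_eq_zero`).
* Part 1 — **cone sections** (`natCast_le_height_span_add_card`): for a homogeneous ideal `I` of
  `k[X₁, …, X_N]` and polynomials `G` without constant term with `V(I) ∩ V(G) = {0}`,
  `N ≤ height I + #G` (catenary dimension formula `ringKrullDim_quotient_add_height` of
  `Literature/RingTheory/KrullDimension/AffineCatenary.lean`, Krull's height theorem — Mathlib
  `Ideal.height_le_ringKrullDim_quotient_add_encard` —, minimal primes of homogeneous ideals are
  homogeneous (`Literature.RingTheory.MvPolynomial.isHomogeneous_of_mem_minimalPrimes`), and the
  Nullstellensatz for primes).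
* Part 7 — the discharge: for arbitrary `n` put `n₀ = min(n, 4)` and take `Φ` = the polynomial of
  Part 6 for the restriction of `c` to the first `n₀` coordinates; a common zero of
  `(f_c, ∂f_c)` inside the coordinate `n₀`-plane restricts to a singular point of the restricted
  cone, hence vanishes, so `n ≤ height + (n - n₀)` by Part 1 with `G = {X_w : w ≥ n₀}`, i.e.
  `height ≥ min(4, n)`; `≤` is `alperBogartVelasco2017_thm_1_7_le`.

## References

* [AlperBogartVelasco2017] J. Alper, T. Bogart, M. Velasco, Found. Comput. Math. 17 (2017)
  829–836, doi:10.1007/s10208-015-9300-x, arXiv:1505.02205 — Thm. 1.7 and its proof (§2, p. 5).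
* [Hartshorne1977] R. Hartshorne, *Algebraic Geometry*, GTM 52 (1977), II Thm. 8.18 (proof: the
  dimension count for the bad hyperplanes), I Thm. 7.2.
* [Harris1992] J. Harris, *Algebraic Geometry, a first course*, GTM 133, Thm. 17.16 (Bertini), as
  cited by ABV.
* [Matsumura1987] H. Matsumura, *Commutative Ring Theory* (1986), Thm. 5.6, Thm. 13.5, Thm. 15.1.
-/

noncomputable section

open Matrix MvPolynomial Finset Module

namespace Literature.Computability.AlgebraicComplexity

namespace ABV17Bertini

universe u v w

/-! ### Part 3. The linear pencil of a coefficient tensor and its singular points -/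

section Pencil

variable {R : Type u} [CommRing R] {m n : ℕ}

/-- The `w`-th coefficient matrix `C_w = (c_{ijw})_{ij}` of a coefficient tensor `c`. [folklore] -/
def coefMat (c : Fin m × Fin m × Fin n → R) (w : Fin n) : Matrix (Fin m) (Fin m) R :=
  Matrix.of fun i j => c (i, j, w)

/-- The pencil value `Y_c(x) = Σ_w x_w C_w`, i.e. `(Y_c(x))_{ij} = Σ_w c_{ijw} x_w`. [folklore] -/
def pencil (c : Fin m × Fin m × Fin n → R) (x : Fin n → R) : Matrix (Fin m) (Fin m) R :=
  Matrix.of fun i j => ∑ w, c (i, j, w) * x w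

omit [CommRing R] in
/-- Entries of `coefMat`. [folklore] -/
@[simp] private theorem coefMat_apply (c : Fin m × Fin m × Fin n → R) (w : Fin n) (i j : Fin m) :
    coefMat c w i j = c (i, j, w) := rfl

/-- Entries of `pencil`. [folklore] -/
@[simp] private theorem pencil_apply (c : Fin m × Fin m × Fin n → R) (x : Fin n → R) (i j : Fin m) :
    pencil c x i j = ∑ w, c (i, j, w) * x w := rfl

/-- ABV's matrix of linear forms `L_c = (Σ_w c_{ijw} X_w)_{ij}` (the matrix in the statement of
`alperBogartVelasco2017_thm_1_7_general`). [cite: AlperBogartVelasco2017, Thm. 1.7] -/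
def linMat (c : Fin m × Fin m × Fin n → R) : Matrix (Fin m) (Fin m) (MvPolynomial (Fin n) R) :=
  Matrix.of fun i j => ∑ w : Fin n, C (c (i, j, w)) * (X w : MvPolynomial (Fin n) R)

/-- Entries of `linMat`. [folklore] -/
private theorem linMat_apply (c : Fin m × Fin m × Fin n → R) (i j : Fin m) :
    linMat c i j = ∑ w : Fin n, C (c (i, j, w)) * (X w : MvPolynomial (Fin n) R) := rfl

/-- The entries of `L_c` are linear forms. [folklore] -/
private theorem linMat_isHomogeneous (c : Fin m × Fin m × Fin n → R) (i j : Fin m) :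
    (linMat c i j).IsHomogeneous 1 := by
  rw [linMat_apply]
  refine IsHomogeneous.sum _ _ _ fun w _ => ?_
  simpa using (isHomogeneous_C _ (c (i, j, w))).mul (isHomogeneous_X R w)

/-- The entries of `L_c` have total degree `≤ 1`. [folklore] -/
private theorem totalDegree_linMat_le (c : Fin m × Fin m × Fin n → R) (i j : Fin m) :
    (linMat c i j).totalDegree ≤ 1 := by
  by_cases h : linMat c i j = 0
  · rw [h, totalDegree_zero]; exact zero_le_one
  · exact ((linMat_isHomogeneous c i j).totalDegree h).le

/-- `L_c(x) = Y_c(x)`. [folklore] -/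
private theorem linMat_map_eval (c : Fin m × Fin m × Fin n → R) (x : Fin n → R) :
    (linMat c).map (eval x) = pencil c x := by
  ext i j
  simp [linMat_apply, map_sum]

/-- `(det L_c)(x) = det Y_c(x)`. [folklore] -/
private theorem eval_det_linMat (c : Fin m × Fin m × Fin n → R) (x : Fin n → R) :
    eval x (linMat c).det = (pencil c x).det := by
  rw [← DeterminantalConormal.det_map_eval, linMat_map_eval]

/-- The derivative matrices of `L_c` are the coefficient matrices: `(∂_w L_c)(x) = C_w`.
[folklore] -/
private theorem linMat_map_eval_pderiv (c : Fin m × Fin m × Fin n → R) (x : Fin n → R) (w : Fin n) :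
    (linMat c).map (fun p => eval x (pderiv w p)) = coefMat c w := by
  ext i j
  rw [Matrix.map_apply, linMat_apply, coefMat_apply, map_sum, map_sum,
    Finset.sum_eq_single w]
  · simp
  · intro w' _ hw'
    simp [pderiv_X, hw']
  · intro h; exact absurd (Finset.mem_univ w) h

/-- **Jacobi's formula for the pencil**: `(∂_w det L_c)(x) = tr(adj Y_c(x) · C_w)` (the tree's
`DeterminantalConormal.eval_pderiv_det`). [folklore] -/
private theorem eval_pderiv_det_linMat (c : Fin m × Fin m × Fin n → R) (x : Fin n → R) (w : Fin n) :
    eval x (pderiv w (linMat c).det) = ((pencil c x).adjugate * coefMat c w).trace := by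
  classical
  rw [DeterminantalConormal.eval_pderiv_det, linMat_map_eval, linMat_map_eval_pderiv]

end Pencil

/-! ### Singular points of the cone: the two kinds -/

section SingularPoints

variable {k : Type u} [Field k] {m n : ℕ}

/-- **Rank drop by two gives two reduced kernel vectors.** If `adj Y = 0` for an `m × m` matrix
over a field, `m ≥ 2`, then there are indices `j₁ ≠ j₂` and kernel vectors `v₁, v₂` of `Y` in
reduced echelon form: `v₁ j₁ = 1, v₁ j₂ = 0, v₂ j₁ = 0, v₂ j₂ = 1`. [folklore] -/
private theorem exists_echelon_kernel_pair_of_adjugate_eq_zero (hm : 2 ≤ m)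
    {Y : Matrix (Fin m) (Fin m) k} (hY : Y.adjugate = 0) :
    ∃ j₁ j₂ : Fin m, j₁ ≠ j₂ ∧ ∃ v₁ v₂ : Fin m → k,
      v₁ j₁ = 1 ∧ v₁ j₂ = 0 ∧ v₂ j₁ = 0 ∧ v₂ j₂ = 1 ∧ Y *ᵥ v₁ = 0 ∧ Y *ᵥ v₂ = 0 := by
  classical
  haveI : Nonempty (Fin m) := ⟨⟨0, by omega⟩⟩
  -- `rank Y ≤ m - 2`, so `dim ker Y ≥ 2`
  have hrk : Y.rank + 2 ≤ m := by
    have h := Literature.LinearAlgebra.Matrix.rank_adjugate Y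
    rw [hY, Matrix.rank_zero, Fintype.card_fin, eq_comm, Nat.choose_eq_zero_iff] at h
    omega
  set W : Submodule k (Fin m → k) := LinearMap.ker Y.mulVecLin with hW
  have hWdim : 2 ≤ finrank k W := by
    have h := LinearMap.finrank_range_add_finrank_ker Y.mulVecLin
    rw [Module.finrank_fintype_fun_eq_card, Fintype.card_fin] at h
    change Y.rank + finrank k W = m at h
    omega
  have hmemW : ∀ {v : Fin m → k}, v ∈ W ↔ Y *ᵥ v = 0 := fun {v} => by
    rw [hW, LinearMap.mem_ker, Matrix.mulVecLin_apply]
  -- a first non-zero kernel vector `a`, normalised at `j₁`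
  obtain ⟨a, haW, ha0⟩ : ∃ a ∈ W, a ≠ 0 := by
    by_contra hcon
    push Not at hcon
    have hbot : W = ⊥ := (Submodule.eq_bot_iff W).2 hcon
    rw [hbot, finrank_bot] at hWdim
    omega
  obtain ⟨j₁, hj₁⟩ : ∃ j, a j ≠ 0 := by
    by_contra hcon
    push Not at hcon
    exact ha0 (funext hcon)
  set a' : Fin m → k := (a j₁)⁻¹ • a with ha'
  have ha'W : a' ∈ W := W.smul_mem _ haW
  have ha'j₁ : a' j₁ = 1 := by simp [ha', hj₁]
  -- a kernel vector `b` outside the line `k a'`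
  obtain ⟨b, hbW, hb⟩ : ∃ b ∈ W, b ∉ (k ∙ a') := by
    by_contra hcon
    push Not at hcon
    have hle : W ≤ k ∙ a' := fun v hv => hcon v hv
    have h1 := Submodule.finrank_mono hle
    have h2 : finrank k (k ∙ a') = 1 :=
      finrank_span_singleton (by intro h; rw [h] at ha'j₁; simp at ha'j₁)
    omega
  set b' : Fin m → k := b - b j₁ • a' with hb'
  have hb'W : b' ∈ W := W.sub_mem hbW (W.smul_mem _ ha'W)
  have hb'j₁ : b' j₁ = 0 := by simp [hb', ha'j₁]
  have hb'0 : b' ≠ 0 := by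
    intro h0
    apply hb
    rw [Submodule.mem_span_singleton]
    refine ⟨b j₁, ?_⟩
    rw [hb', sub_eq_zero] at h0
    exact h0.symm
  obtain ⟨j₂, hj₂⟩ : ∃ j, b' j ≠ 0 := by
    by_contra hcon
    push Not at hcon
    exact hb'0 (funext hcon)
  have hj₁₂ : j₁ ≠ j₂ := by rintro rfl; exact hj₂ hb'j₁
  set v₂ : Fin m → k := (b' j₂)⁻¹ • b' with hv₂
  have hv₂W : v₂ ∈ W := W.smul_mem _ hb'W
  have hv₂j₂ : v₂ j₂ = 1 := by simp [hv₂, hj₂]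
  have hv₂j₁ : v₂ j₁ = 0 := by simp [hv₂, hb'j₁]
  set v₁ : Fin m → k := a' - a' j₂ • v₂ with hv₁
  have hv₁W : v₁ ∈ W := W.sub_mem ha'W (W.smul_mem _ hv₂W)
  have hv₁j₁ : v₁ j₁ = 1 := by simp [hv₁, ha'j₁, hv₂j₁]
  have hv₁j₂ : v₁ j₂ = 0 := by simp [hv₁, hv₂j₂]
  exact ⟨j₁, j₂, hj₁₂, v₁, v₂, hv₁j₁, hv₁j₂, hv₂j₁, hv₂j₂, hmemW.1 hv₁W, hmemW.1 hv₂W⟩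

/-- **The two kinds of singular points.** If `det Y = 0` and `tr(adj Y · C_w) = 0` for all `w`
(`m ≥ 2`), then either `adj Y = 0` (rank `≤ m - 2`: two reduced kernel vectors), or
`adj Y = v uᵀ` for a kernel pair `uᵀ Y = 0`, `Y v = 0`, `u, v ≠ 0` with `uᵀ C_w v = 0` for all
`w` (tangency). [folklore] -/
private theorem singular_point_cases (hm : 2 ≤ m) {Y : Matrix (Fin m) (Fin m) k} (hdet : Y.det = 0)
    (C' : Fin n → Matrix (Fin m) (Fin m) k) (htr : ∀ w, (Y.adjugate * C' w).trace = 0) :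
    (∃ j₁ j₂ : Fin m, j₁ ≠ j₂ ∧ ∃ v₁ v₂ : Fin m → k,
      v₁ j₁ = 1 ∧ v₁ j₂ = 0 ∧ v₂ j₁ = 0 ∧ v₂ j₂ = 1 ∧ Y *ᵥ v₁ = 0 ∧ Y *ᵥ v₂ = 0) ∨
    (∃ u v : Fin m → k, u ≠ 0 ∧ v ≠ 0 ∧ u ᵥ* Y = 0 ∧ Y *ᵥ v = 0 ∧
      ∀ w, u ⬝ᵥ (C' w *ᵥ v) = 0) := by
  by_cases hadj : Y.adjugate = 0
  · exact Or.inl (exists_echelon_kernel_pair_of_adjugate_eq_zero hm hadj)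
  · right
    obtain ⟨u, v, hu, hv, huY, hYv, hadj'⟩ :=
      DeterminantalConormal.exists_kernelPair_of_adjugate_ne_zero hdet hadj
    refine ⟨u, v, hu, hv, huY, hYv, fun w => ?_⟩
    have h := htr w
    rw [hadj', vecMulVec_mul, Matrix.trace_vecMulVec] at h
    rwa [dotProduct_mulVec, dotProduct_comm]

end SingularPoints

/-! ### Part 2. Generic avoidance for linear incidences over an affine space of "positions" -/

section LinearAvoidance

variable (k : Type u) [Field k] {A : Type v} [CommRing A] [Algebra k A]
  {ι : Type w} [Fintype ι] {Q : Type*}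

/-- The universal linear forms `g_q = Σ_p T_p κ_{q p} ∈ A[T]` of a linear incidence with
coefficient matrix `κ` over the ring of positions `A`. [folklore] -/
def linIncidence (κ : Q → ι → A) (q : Q) : MvPolynomial ι A := ∑ p, X p * C (κ q p)

/-- `g_q(a) = Σ_p a_p κ_{q p}` for a parameter `a ∈ k^ι`. [folklore] -/
private theorem eval_linIncidence (κ : Q → ι → A) (q : Q) (a : ι → k) :
    eval (fun p => algebraMap k A (a p)) (linIncidence κ q) = ∑ p, a p • κ q p := by
  simp [linIncidence, map_sum, Algebra.smul_def]

omit [Fintype ι] in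
/-- Modulo an ideal containing the `T_p - y_p`, every polynomial is congruent to its value at
`y`. [folklore] -/
private theorem sub_C_eval_mem {𝔐 : Ideal (MvPolynomial ι A)} {y : ι → A}
    (h : ∀ p, X p - C (y p) ∈ 𝔐) (q : MvPolynomial ι A) : q - C (eval y q) ∈ 𝔐 := by
  induction q using MvPolynomial.induction_on with
  | C a => simp
  | add p q hp hq =>
    have heq : p + q - C (eval y (p + q)) = (p - C (eval y p)) + (q - C (eval y q)) := by
      simp only [map_add]; ring
    rw [heq]
    exact 𝔐.add_mem hp hq
  | mul_X p i hp =>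
    have heq : p * X i - C (eval y (p * X i)) =
        (p - C (eval y p)) * X i + C (eval y p) * (X i - C (y i)) := by
      simp only [map_mul, eval_X]; ring
    rw [heq]
    exact 𝔐.add_mem (𝔐.mul_mem_right _ hp) (𝔐.mul_mem_left _ (h i))

omit [Fintype ι] in
/-- A maximal ideal of `A[T]` containing the `T_p - y_p` is the set of polynomials whose value at
`y` lies in its contraction `𝔐 ∩ A`. [folklore] -/
private theorem eq_comap_comap_eval_of_isMaximal {𝔐 : Ideal (MvPolynomial ι A)} (h𝔐 : 𝔐.IsMaximal)
    {y : ι → A} (h : ∀ p, X p - C (y p) ∈ 𝔐) :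
    𝔐 = (𝔐.comap (C : A →+* MvPolynomial ι A)).comap (eval y) := by
  refine h𝔐.eq_of_le ?_ fun q hq => ?_
  · intro htop
    have h1 : (1 : MvPolynomial ι A) ∈ (𝔐.comap (C : A →+* MvPolynomial ι A)).comap (eval y) :=
      htop ▸ Submodule.mem_top
    rw [Ideal.mem_comap, Ideal.mem_comap, map_one, map_one] at h1
    exact h𝔐.ne_top ((Ideal.eq_top_iff_one _).2 h1)
  · rw [Ideal.mem_comap, Ideal.mem_comap]
    have h2 : C (eval y q) = q - (q - C (eval y q)) := by ring
    rw [h2]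
    exact 𝔐.sub_mem hq (sub_C_eval_mem h q)

omit [Fintype ι] in
/-- Evaluating the scalar extension of `r ∈ k[T]` at `C ∘ a` gives the constant `r(a)`.
[folklore] -/
private theorem eval_map_algebraMap (a : ι → k) (r : MvPolynomial ι k) :
    eval (fun p => algebraMap k A (a p)) (MvPolynomial.map (algebraMap k A) r) =
      algebraMap k A (eval a r) := by
  rw [eval_map, ← coe_eval₂Hom, show algebraMap k A (eval a r) =
    ((algebraMap k A).comp (eval a)) r from rfl]
  congr 1
  apply MvPolynomial.ringHom_ext
  · intro t; simp
  · intro i; simp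

variable [IsAlgClosed k] {τ : Type v} [Fintype τ]

/-- **Generic avoidance for a linear incidence over affine space.** Let `k` be algebraically
closed, `τ` finitely many position coordinates, `ι` finitely many parameters and
`κ : Q × ι → k[τ]` a matrix of polynomials. If at every point `t ∈ k^τ` the `k`-matrix
`κ(t)` has rank `≥ #τ + 1` — "over each position the bad parameters `{a | κ(t) a = 0}` form a
linear space of codimension `> dim` of the position space" — then there is a non-zero
polynomial `h ∈ k[T]` such that for every parameter `a` with `h(a) ≠ 0` and every position `t`,
`κ(t) a ≠ 0`. This is the dimension count of Hartshorne II Thm. 8.18 (Bertini) in the form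
provided by the tree's `Literature.RingTheory.KrullDimension.exists_ne_zero_forall_mem_of_isMaximal`.
[cite: Hartshorne1977, II Thm. 8.18 (proof)] -/
theorem exists_ne_zero_forall_mulVec_ne_zero (κ : Q → ι → MvPolynomial τ k)
    (hrank : ∀ t : τ → k,
      Fintype.card τ + 1 ≤ (Matrix.of fun q p => eval t (κ q p) : Matrix Q ι k).rank) :
    ∃ h : MvPolynomial ι k, h ≠ 0 ∧ ∀ a : ι → k, eval a h ≠ 0 →
      ∀ t : τ → k, (Matrix.of fun q p => eval t (κ q p) : Matrix Q ι k) *ᵥ a ≠ 0 := by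
  classical
  haveI : Algebra.FiniteType k (MvPolynomial ι (MvPolynomial τ k)) :=
    (inferInstance : Algebra.FiniteType k (MvPolynomial τ k)).trans inferInstance
  have hA : ringKrullDim (MvPolynomial τ k) ≤ (Fintype.card τ : ℕ) := by
    rw [MvPolynomial.ringKrullDim_of_isNoetherianRing, ringKrullDim_eq_zero_of_field k, zero_add,
      Nat.card_eq_fintype_card]
  -- the incidence ideal
  set J : Ideal (MvPolynomial ι (MvPolynomial τ k)) :=
    Ideal.span (Set.range (linIncidence κ)) with hJ
  have hgJ : ∀ q, linIncidence κ q ∈ J := fun q => Ideal.subset_span (Set.mem_range_self q)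
  -- evaluation of a generator at the closed point `(t, a)`
  have hgen : ∀ (t : τ → k) (a : ι → k) (q : Q),
      eval t (eval (fun p => algebraMap k (MvPolynomial τ k) (a p)) (linIncidence κ q)) =
        ((Matrix.of fun q p => eval t (κ q p) : Matrix Q ι k) *ᵥ a) q := by
    intro t a q
    rw [eval_linIncidence, map_sum, Matrix.mulVec, dotProduct]
    refine Finset.sum_congr rfl fun p _ => ?_
    rw [Matrix.of_apply, smul_eval, mul_comm]
  -- the fibre hypothesis
  have hfib : ∀ 𝔪 : Ideal (MvPolynomial τ k), 𝔪.IsMaximal →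
      ∃ s : Finset (Ideal (MvPolynomial ι k)),
        (∀ 𝔟 ∈ s, ringKrullDim (MvPolynomial ι k ⧸ 𝔟) + ((Fintype.card τ : ℕ) + 1 : ℕ) ≤
          Nat.card ι) ∧
        ∀ 𝔐 : Ideal (MvPolynomial ι (MvPolynomial τ k)), 𝔐.IsMaximal → J ≤ 𝔐 →
          𝔐.comap (C : MvPolynomial τ k →+* MvPolynomial ι (MvPolynomial τ k)) = 𝔪 →
            ∃ 𝔟 ∈ s, 𝔟.map (MvPolynomial.map (algebraMap k (MvPolynomial τ k))) ≤ 𝔐 := by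
    intro 𝔪 h𝔪
    obtain ⟨t, rfl⟩ := eq_vanishingIdeal_singleton_of_isMaximal k h𝔪
    set Λ : (ι → k) →ₗ[k] (Q → k) :=
      (Matrix.of fun q p => eval t (κ q p) : Matrix Q ι k).mulVecLin with hΛ
    have hrk : Fintype.card τ + 1 ≤ Module.finrank k (LinearMap.range Λ) := hrank t
    refine ⟨{Literature.RingTheory.KrullDimension.linIdeal Λ}, ?_, ?_⟩
    · intro 𝔟 h𝔟
      rw [Finset.mem_singleton] at h𝔟
      subst h𝔟
      have := Literature.RingTheory.KrullDimension.ringKrullDim_quotient_linIdeal_add_le Λ hrk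
      rw [Nat.card_eq_fintype_card (α := ι)]
      exact this
    · intro 𝔐 h𝔐 hJ𝔐 h𝔐𝔪
      -- coordinates `a` of the closed point `𝔐`
      have ha' := fun p =>
        Literature.RingTheory.KrullDimension.exists_sub_algebraMap_mem_of_isMaximal k 𝔐
          (X p : MvPolynomial ι (MvPolynomial τ k))
      choose a ha using ha'
      have hX : ∀ p, X p - C (algebraMap k (MvPolynomial τ k) (a p)) ∈ 𝔐 := fun p => by
        rw [← MvPolynomial.algebraMap_apply]
        exact ha p
      have h𝔐eq := eq_comap_comap_eval_of_isMaximal h𝔐 hX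
      rw [h𝔐𝔪] at h𝔐eq
      -- the generators vanish at `(t, a)`: `Λ a = 0`
      have hker : Λ a = 0 := by
        funext q
        rw [hΛ, Matrix.mulVecLin_apply, Pi.zero_apply, ← hgen t a q]
        have h1 : linIncidence κ q ∈ 𝔐 := hJ𝔐 (hgJ q)
        rw [h𝔐eq, Ideal.mem_comap, mem_vanishingIdeal_singleton_iff, aeval_eq_eval] at h1
        exact h1
      refine ⟨_, Finset.mem_singleton_self _, ?_⟩
      have hle := Literature.RingTheory.KrullDimension.linIdeal_le_ker_eval Λ hker
      rw [Ideal.map_le_iff_le_comap]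
      intro r hr
      rw [Ideal.mem_comap, h𝔐eq, Ideal.mem_comap, eval_map_algebraMap,
        (RingHom.mem_ker.mp (hle hr)), map_zero]
      exact zero_mem _
  -- generic avoidance
  obtain ⟨h, hh0, hh⟩ :=
    Literature.RingTheory.KrullDimension.exists_ne_zero_forall_mem_of_isMaximal k _ hA J hfib
  refine ⟨h, hh0, fun a ha t ht => ?_⟩
  -- the closed point `(t, a)` lies on the incidence, so `h(a) ∈ 𝔪_t`: contradiction
  set y : ι → MvPolynomial τ k := fun p => algebraMap k (MvPolynomial τ k) (a p) with hy
  have hsurj : Function.Surjective (eval y) := fun x => ⟨C x, eval_C x⟩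
  set 𝔐 : Ideal (MvPolynomial ι (MvPolynomial τ k)) :=
    ((vanishingIdeal k {t} : Ideal (MvPolynomial τ k))).comap (eval y) with h𝔐
  haveI : 𝔐.IsMaximal := Ideal.comap_isMaximal_of_surjective _ hsurj
  have hJ𝔐 : J ≤ 𝔐 := by
    rw [hJ, Ideal.span_le]
    rintro _ ⟨q, rfl⟩
    rw [SetLike.mem_coe, h𝔐, Ideal.mem_comap, mem_vanishingIdeal_singleton_iff, aeval_eq_eval,
      hy, hgen t a q, ht, Pi.zero_apply]
  have h1 := hh 𝔐 inferInstance hJ𝔐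
  rw [h𝔐, Ideal.mem_comap, hy, eval_map_algebraMap, mem_vanishingIdeal_singleton_iff,
    MvPolynomial.algebraMap_eq, aeval_C, Algebra.algebraMap_self_apply] at h1
  exact ha h1

end LinearAvoidance

/-! ### Part 4. The rank-drop incidence (S): charts of `ℙ^{n-1} × Gr(2, m)` -/

section RankDropIncidence

variable {R : Type u} [CommRing R] {S : Type v} [CommRing S] {m n : ℕ}

/-- Coefficient matrix of the linear incidence "`Y_c(x) v₁ = 0`, `Y_c(x) v₂ = 0`" in the
parameters `c`: rows indexed by `Fin m ⊕ Fin m`. [folklore] -/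
def kapS (x : Fin n → R) (v₁ v₂ : Fin m → R) : Fin m ⊕ Fin m → Fin m × Fin m × Fin n → R
  | Sum.inl i => fun p => if p.1 = i then x p.2.2 * v₁ p.2.1 else 0
  | Sum.inr i => fun p => if p.1 = i then x p.2.2 * v₂ p.2.1 else 0

omit [CommRing S] in
/-- A row of `kapS` applied to `c` is a coordinate of `Y_c(x) v`. [folklore] -/
private theorem sum_ite_mul_eq_pencil_mulVec (x : Fin n → R) (v : Fin m → R)
    (c : Fin m × Fin m × Fin n → R) (i : Fin m) :
    ∑ p : Fin m × Fin m × Fin n, (if p.1 = i then x p.2.2 * v p.2.1 else 0) * c p =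
      (pencil c x *ᵥ v) i := by
  rw [Fintype.sum_prod_type, Finset.sum_eq_single i]
  · rw [Matrix.mulVec, dotProduct, Fintype.sum_prod_type]
    refine Finset.sum_congr rfl fun j _ => ?_
    rw [pencil_apply, Finset.sum_mul]
    refine Finset.sum_congr rfl fun w _ => ?_
    simp only [if_true]
    ring
  · intro i' _ hi'
    simp [hi']
  · intro h; exact absurd (Finset.mem_univ i) h

omit [CommRing S] in
/-- `kapS(x, v₁, v₂) · c = (Y_c(x) v₁, Y_c(x) v₂)`. [folklore] -/
private theorem of_kapS_mulVec (x : Fin n → R) (v₁ v₂ : Fin m → R) (c : Fin m × Fin m × Fin n → R) :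
    Matrix.of (kapS x v₁ v₂) *ᵥ c = Sum.elim (pencil c x *ᵥ v₁) (pencil c x *ᵥ v₂) := by
  ext q
  rcases q with i | i
  · rw [Matrix.mulVec, dotProduct, Sum.elim_inl]
    exact sum_ite_mul_eq_pencil_mulVec x v₁ c i
  · rw [Matrix.mulVec, dotProduct, Sum.elim_inr]
    exact sum_ite_mul_eq_pencil_mulVec x v₂ c i

/-- `kapS` commutes with ring homomorphisms. [folklore] -/
private theorem map_kapS (f : R →+* S) (x : Fin n → R) (v₁ v₂ : Fin m → R) (q : Fin m ⊕ Fin m)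
    (p : Fin m × Fin m × Fin n) :
    f (kapS x v₁ v₂ q p) = kapS (fun w => f (x w)) (fun j => f (v₁ j)) (fun j => f (v₂ j)) q p := by
  rcases q with i | i <;> · simp only [kapS]; split_ifs <;> simp

variable {k : Type u} [Field k]

/-- **Full row rank of the rank-drop incidence on a chart**: if `x_{w₀} = 1` and `v₁, v₂` are in
reduced echelon form with pivots `j₁ ≠ j₂`, then `c ↦ (Y_c(x) v₁, Y_c(x) v₂)` is surjective onto
`k^m × k^m`. [folklore] -/
private theorem kapS_mulVec_surjective {x : Fin n → k} {v₁ v₂ : Fin m → k} {w₀ : Fin n} {j₁ j₂ : Fin m}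
    (hj : j₁ ≠ j₂) (hx : x w₀ = 1) (h₁₁ : v₁ j₁ = 1) (h₁₂ : v₁ j₂ = 0) (h₂₁ : v₂ j₁ = 0)
    (h₂₂ : v₂ j₂ = 1) :
    Function.Surjective (Matrix.of (kapS x v₁ v₂)).mulVecLin := by
  classical
  intro pq
  -- the matrix with columns `j₁ ↦ p`, `j₂ ↦ q`, placed in the slot `w₀`
  let M : Matrix (Fin m) (Fin m) k := fun i j =>
    if j = j₁ then pq (Sum.inl i) else if j = j₂ then pq (Sum.inr i) else 0
  refine ⟨fun p => if p.2.2 = w₀ then M p.1 p.2.1 else 0, ?_⟩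
  rw [Matrix.mulVecLin_apply, of_kapS_mulVec]
  have hpencil : pencil (fun p : Fin m × Fin m × Fin n => if p.2.2 = w₀ then M p.1 p.2.1 else 0) x
      = M := by
    ext i j
    rw [pencil_apply, Finset.sum_eq_single w₀]
    · simp [hx]
    · intro w _ hw; simp [hw]
    · intro h; exact absurd (Finset.mem_univ w₀) h
  have hM₁ : M *ᵥ v₁ = fun i => pq (Sum.inl i) := by
    funext i
    rw [Matrix.mulVec, dotProduct, Finset.sum_eq_single j₁]
    · simp [M, h₁₁]
    · intro j _ hj'
      by_cases hj2 : j = j₂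
      · subst hj2; simp [M, hj', h₁₂]
      · simp [M, hj', hj2]
    · intro h; exact absurd (Finset.mem_univ j₁) h
  have hM₂ : M *ᵥ v₂ = fun i => pq (Sum.inr i) := by
    funext i
    rw [Matrix.mulVec, dotProduct, Finset.sum_eq_single j₂]
    · simp [M, hj.symm, h₂₂]
    · intro j _ hj'
      by_cases hj1 : j = j₁
      · subst hj1; simp [M, h₂₁]
      · simp [M, hj', hj1]
    · intro h; exact absurd (Finset.mem_univ j₂) h
  rw [hpencil, hM₁, hM₂]
  funext q
  rcases q with i | i <;> rfl

/-- Position variables of the chart `(w₀, j₁, j₂)` of `ℙ^{n-1} × Gr(2, m)`: the coordinates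
`x_w (w ≠ w₀)` and the free entries of two reduced kernel vectors. [folklore] -/
abbrev VarS (w₀ : Fin n) (j₁ j₂ : Fin m) : Type :=
  {w : Fin n // w ≠ w₀} ⊕ ({j : {j : Fin m // j ≠ j₁} // j.1 ≠ j₂} ⊕
    {j : {j : Fin m // j ≠ j₁} // j.1 ≠ j₂})

/-- The point of the chart: `x` with `x_{w₀} = 1`. [folklore] -/
def xPtS {w₀ : Fin n} {j₁ j₂ : Fin m} (t : VarS w₀ j₁ j₂ → R) : Fin n → R :=
  fun w => if h : w = w₀ then 1 else t (Sum.inl ⟨w, h⟩)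

/-- The first reduced kernel vector of the chart: `v₁ j₁ = 1`, `v₁ j₂ = 0`. [folklore] -/
def v₁PtS {w₀ : Fin n} {j₁ j₂ : Fin m} (t : VarS w₀ j₁ j₂ → R) : Fin m → R :=
  fun j => if h₁ : j = j₁ then 1 else if h₂ : j = j₂ then 0 else t (Sum.inr (Sum.inl ⟨⟨j, h₁⟩, h₂⟩))

/-- The second reduced kernel vector of the chart: `v₂ j₁ = 0`, `v₂ j₂ = 1`. [folklore] -/
def v₂PtS {w₀ : Fin n} {j₁ j₂ : Fin m} (t : VarS w₀ j₁ j₂ → R) : Fin m → R :=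
  fun j => if h₁ : j = j₁ then 0 else if h₂ : j = j₂ then 1 else t (Sum.inr (Sum.inr ⟨⟨j, h₁⟩, h₂⟩))

/-- `xPtS` commutes with ring homomorphisms. [folklore] -/
private theorem map_xPtS {w₀ : Fin n} {j₁ j₂ : Fin m} (f : R →+* S) (t : VarS w₀ j₁ j₂ → R) (w : Fin n) :
    f (xPtS t w) = xPtS (fun a => f (t a)) w := by
  unfold xPtS; split_ifs <;> simp

/-- `v₁PtS` commutes with ring homomorphisms. [folklore] -/
private theorem map_v₁PtS {w₀ : Fin n} {j₁ j₂ : Fin m} (f : R →+* S) (t : VarS w₀ j₁ j₂ → R) (j : Fin m) :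
    f (v₁PtS t j) = v₁PtS (fun a => f (t a)) j := by
  unfold v₁PtS; split_ifs <;> simp

/-- `v₂PtS` commutes with ring homomorphisms. [folklore] -/
private theorem map_v₂PtS {w₀ : Fin n} {j₁ j₂ : Fin m} (f : R →+* S) (t : VarS w₀ j₁ j₂ → R) (j : Fin m) :
    f (v₂PtS t j) = v₂PtS (fun a => f (t a)) j := by
  unfold v₂PtS; split_ifs <;> simp

/-- The chart normalisation `x_{w₀} = 1`. [folklore] -/
private theorem xPtS_self {w₀ : Fin n} {j₁ j₂ : Fin m} (t : VarS w₀ j₁ j₂ → R) :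
    xPtS t w₀ = 1 := by
  simp [xPtS]

/-- The universal matrix of the rank-drop incidence on the chart `(w₀, j₁, j₂)`, with entries in
the polynomial ring of the position variables. [folklore] -/
def kapSU (k : Type u) [Field k] (w₀ : Fin n) (j₁ j₂ : Fin m) :
    Fin m ⊕ Fin m → Fin m × Fin m × Fin n → MvPolynomial (VarS w₀ j₁ j₂) k :=
  kapS (xPtS X) (v₁PtS X) (v₂PtS X)

/-- Evaluating the universal matrix at a point of the chart. [folklore] -/
private theorem eval_kapSU {w₀ : Fin n} {j₁ j₂ : Fin m} (t : VarS w₀ j₁ j₂ → k) (q : Fin m ⊕ Fin m)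
    (p : Fin m × Fin m × Fin n) :
    eval t (kapSU k w₀ j₁ j₂ q p) = kapS (xPtS t) (v₁PtS t) (v₂PtS t) q p := by
  rw [kapSU, map_kapS]
  congr 1
  · funext w; rw [map_xPtS]; simp
  · funext j; rw [map_v₁PtS]; simp
  · funext j; rw [map_v₂PtS]; simp

/-- The rank hypothesis of generic avoidance for the rank-drop incidence: on each chart the
universal matrix has full row rank `2m ≥ dim(chart) + 1` as soon as `n ≤ 4`. [folklore] -/
private theorem card_varS_add_one_le_rank (hn : n ≤ 4) {w₀ : Fin n} {j₁ j₂ : Fin m} (hj : j₁ ≠ j₂)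
    (t : VarS w₀ j₁ j₂ → k) :
    Fintype.card (VarS w₀ j₁ j₂) + 1 ≤
      (Matrix.of fun q p => eval t (kapSU k w₀ j₁ j₂ q p) : Matrix (Fin m ⊕ Fin m) _ k).rank := by
  classical
  have hmat : (Matrix.of fun q p => eval t (kapSU k w₀ j₁ j₂ q p)) =
      Matrix.of (kapS (xPtS t) (v₁PtS t) (v₂PtS t)) := by
    ext q p; exact eval_kapSU t q p
  have hsurj := kapS_mulVec_surjective (k := k) (x := xPtS t) (v₁ := v₁PtS t) (v₂ := v₂PtS t)
    (w₀ := w₀) hj (xPtS_self t) (by simp [v₁PtS]) (by simp [v₁PtS, hj.symm]) (by simp [v₂PtS])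
    (by simp [v₂PtS, hj.symm])
  rw [hmat, Matrix.rank, LinearMap.range_eq_top.2 hsurj, finrank_top,
    Module.finrank_fintype_fun_eq_card]
  simp only [Fintype.card_sum, Fintype.card_fin]
  -- count the position variables
  have h1 : Fintype.card {w : Fin n // w ≠ w₀} < n := by
    simpa using Fintype.card_subtype_lt (p := fun w : Fin n => w ≠ w₀) (x := w₀) (by simp)
  have h2 : Fintype.card {j : Fin m // j ≠ j₁} < m := by
    simpa using Fintype.card_subtype_lt (p := fun j : Fin m => j ≠ j₁) (x := j₁) (by simp)
  have h3 : Fintype.card {j : {j : Fin m // j ≠ j₁} // j.1 ≠ j₂} <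
      Fintype.card {j : Fin m // j ≠ j₁} :=
    Fintype.card_subtype_lt (p := fun j : {j : Fin m // j ≠ j₁} => j.1 ≠ j₂)
      (x := ⟨j₂, hj.symm⟩) (by simp)
  omega

variable (k) [IsAlgClosed k]

/-- **Genericity (S): a general pencil meets the rank `≤ m - 2` locus only at the origin when
`n ≤ 4`.** There is a non-zero polynomial `Φ_S(c)` such that for `Φ_S(c) ≠ 0`, no `x ≠ 0` has two
reduced-echelon kernel vectors of `Y_c(x)` — by generic avoidance on the charts of
`ℙ^{n-1} × Gr(2, m)` (bad parameters linear of codimension `2m ≥ (n-1) + 2(m-2) + 1`).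
[cite: Hartshorne1977, II Thm. 8.18 (proof)] -/
theorem exists_generic_no_rankDrop (hn : n ≤ 4) :
    ∃ Φ : MvPolynomial (Fin m × Fin m × Fin n) k, Φ ≠ 0 ∧
      ∀ c : Fin m × Fin m × Fin n → k, eval c Φ ≠ 0 → ∀ x : Fin n → k, x ≠ 0 →
        ∀ j₁ j₂ : Fin m, j₁ ≠ j₂ → ∀ v₁ v₂ : Fin m → k,
          v₁ j₁ = 1 → v₁ j₂ = 0 → v₂ j₁ = 0 → v₂ j₂ = 1 →
            pencil c x *ᵥ v₁ = 0 → pencil c x *ᵥ v₂ = 0 → False := by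
  classical
  -- one polynomial per chart `(w₀, j₁, j₂)`
  have hchart : ∀ ch : Fin n × Fin m × Fin m, ∃ h : MvPolynomial (Fin m × Fin m × Fin n) k,
      h ≠ 0 ∧ (ch.2.1 ≠ ch.2.2 → ∀ c : Fin m × Fin m × Fin n → k, eval c h ≠ 0 →
        ∀ x : Fin n → k, x ch.1 = 1 → ∀ v₁ v₂ : Fin m → k,
          v₁ ch.2.1 = 1 → v₁ ch.2.2 = 0 → v₂ ch.2.1 = 0 → v₂ ch.2.2 = 1 →
            pencil c x *ᵥ v₁ = 0 → pencil c x *ᵥ v₂ = 0 → False) := by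
    rintro ⟨w₀, j₁, j₂⟩
    by_cases hj : j₁ = j₂
    · exact ⟨1, one_ne_zero, fun h => absurd hj h⟩
    obtain ⟨h, hh0, hh⟩ := exists_ne_zero_forall_mulVec_ne_zero k (kapSU k w₀ j₁ j₂)
      (card_varS_add_one_le_rank hn hj)
    refine ⟨h, hh0, fun _ c hc x hx v₁ v₂ h₁₁ h₁₂ h₂₁ h₂₂ hv₁ hv₂ => ?_⟩
    -- the point of the chart
    let t : VarS w₀ j₁ j₂ → k :=
      Sum.elim (fun w => x w.1) (Sum.elim (fun j => v₁ j.1.1) (fun j => v₂ j.1.1))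
    have hxt : xPtS t = x := by
      funext w
      by_cases hw : w = w₀
      · subst hw; rw [xPtS_self, hx]
      · simp [xPtS, hw, t]
    have hv₁t : v₁PtS t = v₁ := by
      funext j
      by_cases hj1 : j = j₁
      · subst hj1; simp [v₁PtS, h₁₁]
      · by_cases hj2 : j = j₂
        · subst hj2; simp [v₁PtS, hj1, h₁₂]
        · simp [v₁PtS, hj1, hj2, t]
    have hv₂t : v₂PtS t = v₂ := by
      funext j
      by_cases hj1 : j = j₁
      · subst hj1; simp [v₂PtS, h₂₁]
      · by_cases hj2 : j = j₂
        · subst hj2; simp [v₂PtS, hj1, h₂₂]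
        · simp [v₂PtS, hj1, hj2, t]
    refine hh c hc t ?_
    have hmat : (Matrix.of fun q p => eval t (kapSU k w₀ j₁ j₂ q p)) =
        Matrix.of (kapS x v₁ v₂) := by
      ext q p; rw [Matrix.of_apply, eval_kapSU, hxt, hv₁t, hv₂t, Matrix.of_apply]
    rw [hmat, of_kapS_mulVec, hv₁, hv₂]
    funext q; rcases q with i | i <;> rfl
  choose h hh0 hh using hchart
  refine ⟨∏ ch, h ch, Finset.prod_ne_zero_iff.2 fun ch _ => hh0 ch,
    fun c hc x hx j₁ j₂ hj v₁ v₂ h₁₁ h₁₂ h₂₁ h₂₂ hv₁ hv₂ => ?_⟩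
  obtain ⟨w₀, hw₀⟩ : ∃ w, x w ≠ 0 := by
    by_contra hcon
    push Not at hcon
    exact hx (funext hcon)
  have hc' : eval c (h (w₀, j₁, j₂)) ≠ 0 := by
    rw [map_prod] at hc
    exact (Finset.prod_ne_zero_iff.1 hc) _ (Finset.mem_univ _)
  -- rescale `x` to the chart `x_{w₀} = 1`
  set x' : Fin n → k := (x w₀)⁻¹ • x with hx'
  have hx'1 : x' w₀ = 1 := by simp [hx', hw₀]
  have hpencil : pencil c x' = (x w₀)⁻¹ • pencil c x := by
    ext i j
    simp only [pencil_apply, hx', Pi.smul_apply, smul_eq_mul, Matrix.smul_apply, Finset.mul_sum]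
    refine Finset.sum_congr rfl fun w _ => ?_
    ring
  have hv₁' : pencil c x' *ᵥ v₁ = 0 := by rw [hpencil, Matrix.smul_mulVec, hv₁, smul_zero]
  have hv₂' : pencil c x' *ᵥ v₂ = 0 := by rw [hpencil, Matrix.smul_mulVec, hv₂, smul_zero]
  exact hh (w₀, j₁, j₂) hj c hc' x' hx'1 v₁ v₂ h₁₁ h₁₂ h₂₁ h₂₂ hv₁' hv₂'

end RankDropIncidence

/-! ### Part 5. The tangency incidence (T): charts of `ℙ^{n-1} × ℙ^{m-1} × ℙ^{m-1}` -/

section TangencyIncidence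

variable {R : Type u} [CommRing R] {S : Type v} [CommRing S] {m n : ℕ}

/-- Rows of the (reduced) tangency incidence on the chart with pivots `w₀, j₀`: the `m`
coordinates of `Y v`, the coordinates `j ≠ j₀` of `uᵀ Y`, and the values `uᵀ C_w v`, `w ≠ w₀`
(the two dropped rows are implied by the others on the incidence). [folklore] -/
abbrev RowT (m n : ℕ) (w₀ : Fin n) (j₀ : Fin m) : Type :=
  Fin m ⊕ ({j : Fin m // j ≠ j₀} ⊕ {w : Fin n // w ≠ w₀})

/-- Coefficient matrix of the tangency incidence "`Y v = 0`, `uᵀ Y = 0`, `uᵀ C_w v = 0`" in the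
parameters `c`. [folklore] -/
def kapT {w₀ : Fin n} {j₀ : Fin m} (x : Fin n → R) (u v : Fin m → R) :
    RowT m n w₀ j₀ → Fin m × Fin m × Fin n → R
  | Sum.inl i => fun p => if p.1 = i then x p.2.2 * v p.2.1 else 0
  | Sum.inr (Sum.inl j) => fun p => if p.2.1 = j.1 then u p.1 * x p.2.2 else 0
  | Sum.inr (Sum.inr w) => fun p => if p.2.2 = w.1 then u p.1 * v p.2.1 else 0

omit [CommRing S] in
/-- A `uᵀ Y`-row of `kapT` applied to `c`. [folklore] -/
private theorem sum_ite_mul_eq_vecMul_pencil (x : Fin n → R) (u : Fin m → R)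
    (c : Fin m × Fin m × Fin n → R) (j : Fin m) :
    ∑ p : Fin m × Fin m × Fin n, (if p.2.1 = j then u p.1 * x p.2.2 else 0) * c p =
      (u ᵥ* pencil c x) j := by
  rw [Fintype.sum_prod_type, Matrix.vecMul, dotProduct]
  refine Finset.sum_congr rfl fun i _ => ?_
  rw [Fintype.sum_prod_type, Finset.sum_eq_single j]
  · rw [pencil_apply, Finset.mul_sum]
    refine Finset.sum_congr rfl fun w _ => ?_
    simp only [if_true]
    ring
  · intro j' _ hj'
    simp [hj']
  · intro h; exact absurd (Finset.mem_univ j) h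

omit [CommRing S] in
/-- A `uᵀ C_w v`-row of `kapT` applied to `c`. [folklore] -/
private theorem sum_ite_mul_eq_dotProduct_coefMat_mulVec (u v : Fin m → R)
    (c : Fin m × Fin m × Fin n → R) (w : Fin n) :
    ∑ p : Fin m × Fin m × Fin n, (if p.2.2 = w then u p.1 * v p.2.1 else 0) * c p =
      u ⬝ᵥ (coefMat c w *ᵥ v) := by
  rw [Fintype.sum_prod_type, dotProduct]
  refine Finset.sum_congr rfl fun i _ => ?_
  rw [Fintype.sum_prod_type, Matrix.mulVec, dotProduct, Finset.mul_sum]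
  refine Finset.sum_congr rfl fun j _ => ?_
  rw [Finset.sum_eq_single w]
  · simp only [if_true, coefMat_apply]
    ring
  · intro w' _ hw'
    simp [hw']
  · intro h; exact absurd (Finset.mem_univ w) h

omit [CommRing S] in
/-- `kapT(x, u, v) · c = (Y_c(x) v, (uᵀ Y_c(x))_{j ≠ j₀}, (uᵀ C_w v)_{w ≠ w₀})`. [folklore] -/
private theorem of_kapT_mulVec {w₀ : Fin n} {j₀ : Fin m} (x : Fin n → R) (u v : Fin m → R)
    (c : Fin m × Fin m × Fin n → R) :
    Matrix.of (kapT (w₀ := w₀) (j₀ := j₀) x u v) *ᵥ c =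
      Sum.elim (pencil c x *ᵥ v)
        (Sum.elim (fun j => (u ᵥ* pencil c x) j.1) (fun w => u ⬝ᵥ (coefMat c w.1 *ᵥ v))) := by
  ext q
  rcases q with i | j | w
  · rw [Matrix.mulVec, dotProduct, Sum.elim_inl]
    exact sum_ite_mul_eq_pencil_mulVec x v c i
  · rw [Matrix.mulVec, dotProduct, Sum.elim_inr, Sum.elim_inl]
    exact sum_ite_mul_eq_vecMul_pencil x u c j.1
  · rw [Matrix.mulVec, dotProduct, Sum.elim_inr, Sum.elim_inr]
    exact sum_ite_mul_eq_dotProduct_coefMat_mulVec u v c w.1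

/-- `kapT` commutes with ring homomorphisms. [folklore] -/
private theorem map_kapT {w₀ : Fin n} {j₀ : Fin m} (f : R →+* S) (x : Fin n → R) (u v : Fin m → R)
    (q : RowT m n w₀ j₀) (p : Fin m × Fin m × Fin n) :
    f (kapT x u v q p) = kapT (fun w => f (x w)) (fun i => f (u i)) (fun j => f (v j)) q p := by
  rcases q with i | j | w <;> · simp only [kapT]; split_ifs <;> simp

variable {k : Type u} [Field k]

/-- **Full row rank of the tangency incidence on a chart**: if `x_{w₀} = u_{i₀} = v_{j₀} = 1`
then `c ↦ (Y v, (uᵀ Y)_{j ≠ j₀}, (uᵀ C_w v)_{w ≠ w₀})` is surjective. [folklore] -/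
private theorem kapT_mulVec_surjective {x : Fin n → k} {u v : Fin m → k} {w₀ : Fin n} {i₀ j₀ : Fin m}
    (hx : x w₀ = 1) (hu : u i₀ = 1) (hv : v j₀ = 1) :
    Function.Surjective (Matrix.of (kapT (w₀ := w₀) (j₀ := j₀) x u v)).mulVecLin := by
  classical
  intro T
  -- the completed row target `q''` with `q'' · v = 0`
  let q'' : Fin m → k := fun j =>
    if h : j = j₀ then -(∑ j' : {j : Fin m // j ≠ j₀}, T (Sum.inr (Sum.inl j')) * v j'.1)
    else T (Sum.inr (Sum.inl ⟨j, h⟩))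
  -- `M = p e_{j₀}ᵀ + e_{i₀} q''ᵀ` and `E = e_{i₀} e_{j₀}ᵀ`
  let M : Matrix (Fin m) (Fin m) k := fun i j =>
    (if j = j₀ then T (Sum.inl i) else 0) + (if i = i₀ then q'' j else 0)
  let E : Matrix (Fin m) (Fin m) k := fun i j => if i = i₀ then (if j = j₀ then 1 else 0) else 0
  let c : Fin m × Fin m × Fin n → k := fun r =>
    if h : r.2.2 = w₀ then
      M r.1 r.2.1 - ∑ w' : {w : Fin n // w ≠ w₀}, x w'.1 * (T (Sum.inr (Sum.inr w')) * E r.1 r.2.1)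
    else T (Sum.inr (Sum.inr ⟨r.2.2, h⟩)) * E r.1 r.2.1
  refine ⟨c, ?_⟩
  rw [Matrix.mulVecLin_apply, of_kapT_mulVec]
  have hq''ne : ∀ j' : {j : Fin m // j ≠ j₀}, q'' j'.1 = T (Sum.inr (Sum.inl j')) := fun j' => by
    simp [q'', j'.2]
  have hq''0 : q'' j₀ = -(∑ j' : {j : Fin m // j ≠ j₀}, T (Sum.inr (Sum.inl j')) * v j'.1) := by
    simp [q'']
  have hq'' : ∑ j, q'' j * v j = 0 := by
    rw [Fintype.sum_eq_add_sum_subtype_ne _ j₀, hq''0, hv, mul_one]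
    simp_rw [hq''ne]
    ring
  have hpencil : pencil c x = M := by
    ext i j
    rw [pencil_apply, Fintype.sum_eq_add_sum_subtype_ne _ w₀]
    have h1 : c (i, j, w₀) = M i j -
        ∑ w' : {w : Fin n // w ≠ w₀}, x w'.1 * (T (Sum.inr (Sum.inr w')) * E i j) := by
      simp [c]
    have h2 : ∀ w' : {w : Fin n // w ≠ w₀},
        c (i, j, w'.1) = T (Sum.inr (Sum.inr w')) * E i j := fun w' => by
      simp [c, w'.2]
    rw [h1, hx, mul_one]
    simp_rw [h2]
    have h3 : ∑ w' : {w : Fin n // w ≠ w₀}, T (Sum.inr (Sum.inr w')) * E i j * x w'.1 =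
        ∑ w' : {w : Fin n // w ≠ w₀}, x w'.1 * (T (Sum.inr (Sum.inr w')) * E i j) :=
      Finset.sum_congr rfl fun w' _ => by ring
    rw [h3]
    ring
  have hcoef : ∀ w' : {w : Fin n // w ≠ w₀}, coefMat c w'.1 = T (Sum.inr (Sum.inr w')) • E :=
    fun w' => by
    ext i j
    simp [coefMat, c, w'.2, E]
  have hMv : M *ᵥ v = fun i => T (Sum.inl i) := by
    funext i
    rw [Matrix.mulVec, dotProduct]
    simp only [M, add_mul, Finset.sum_add_distrib, ite_mul, zero_mul, Finset.sum_ite_eq',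
      Finset.mem_univ, if_true, hv, mul_one]
    by_cases hi : i = i₀
    · simp [hi, hq'']
    · simp [hi]
  have huM : ∀ j' : {j : Fin m // j ≠ j₀}, (u ᵥ* M) j'.1 = T (Sum.inr (Sum.inl j')) := by
    intro j'
    rw [Matrix.vecMul, dotProduct]
    simp only [M, j'.2, if_false, mul_zero, zero_add, mul_ite, Finset.sum_ite_eq', Finset.mem_univ,
      if_true, hu, one_mul]
    exact hq''ne j'
  have huEv : u ⬝ᵥ (E *ᵥ v) = 1 := by
    rw [dotProduct, Finset.sum_eq_single i₀]
    · rw [Matrix.mulVec, dotProduct, Finset.sum_eq_single j₀]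
      · simp [E, hu, hv]
      · intro j _ hj; simp [E, hj]
      · intro h; exact absurd (Finset.mem_univ j₀) h
    · intro i _ hi
      rw [Matrix.mulVec, dotProduct]
      simp [E, hi]
    · intro h; exact absurd (Finset.mem_univ i₀) h
  rw [hpencil, hMv]
  funext q
  rcases q with i | j | w
  · rfl
  · simp only [Sum.elim_inr, Sum.elim_inl]
    exact huM j
  · simp only [Sum.elim_inr]
    rw [hcoef w, Matrix.smul_mulVec, dotProduct_smul, huEv, smul_eq_mul, mul_one]

/-- Position variables of the chart `(w₀, i₀, j₀)` of `ℙ^{n-1} × ℙ^{m-1} × ℙ^{m-1}`. [folklore] -/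
abbrev VarT (w₀ : Fin n) (i₀ j₀ : Fin m) : Type :=
  {w : Fin n // w ≠ w₀} ⊕ ({i : Fin m // i ≠ i₀} ⊕ {j : Fin m // j ≠ j₀})

/-- The point of the chart: `x` with `x_{w₀} = 1`. [folklore] -/
def xPtT {w₀ : Fin n} {i₀ j₀ : Fin m} (t : VarT w₀ i₀ j₀ → R) : Fin n → R :=
  fun w => if h : w = w₀ then 1 else t (Sum.inl ⟨w, h⟩)

/-- The left kernel vector of the chart: `u_{i₀} = 1`. [folklore] -/
def uPtT {w₀ : Fin n} {i₀ j₀ : Fin m} (t : VarT w₀ i₀ j₀ → R) : Fin m → R :=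
  fun i => if h : i = i₀ then 1 else t (Sum.inr (Sum.inl ⟨i, h⟩))

/-- The right kernel vector of the chart: `v_{j₀} = 1`. [folklore] -/
def vPtT {w₀ : Fin n} {i₀ j₀ : Fin m} (t : VarT w₀ i₀ j₀ → R) : Fin m → R :=
  fun j => if h : j = j₀ then 1 else t (Sum.inr (Sum.inr ⟨j, h⟩))

/-- `xPtT` commutes with ring homomorphisms. [folklore] -/
private theorem map_xPtT {w₀ : Fin n} {i₀ j₀ : Fin m} (f : R →+* S) (t : VarT w₀ i₀ j₀ → R) (w : Fin n) :
    f (xPtT t w) = xPtT (fun a => f (t a)) w := by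
  unfold xPtT; split_ifs <;> simp

/-- `uPtT` commutes with ring homomorphisms. [folklore] -/
private theorem map_uPtT {w₀ : Fin n} {i₀ j₀ : Fin m} (f : R →+* S) (t : VarT w₀ i₀ j₀ → R) (i : Fin m) :
    f (uPtT t i) = uPtT (fun a => f (t a)) i := by
  unfold uPtT; split_ifs <;> simp

/-- `vPtT` commutes with ring homomorphisms. [folklore] -/
private theorem map_vPtT {w₀ : Fin n} {i₀ j₀ : Fin m} (f : R →+* S) (t : VarT w₀ i₀ j₀ → R) (j : Fin m) :
    f (vPtT t j) = vPtT (fun a => f (t a)) j := by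
  unfold vPtT; split_ifs <;> simp

/-- The universal matrix of the tangency incidence on the chart `(w₀, i₀, j₀)`. [folklore] -/
def kapTU (k : Type u) [Field k] (w₀ : Fin n) (i₀ j₀ : Fin m) :
    RowT m n w₀ j₀ → Fin m × Fin m × Fin n → MvPolynomial (VarT w₀ i₀ j₀) k :=
  kapT (xPtT X) (uPtT X) (vPtT X)

/-- Evaluating the universal matrix at a point of the chart. [folklore] -/
private theorem eval_kapTU {w₀ : Fin n} {i₀ j₀ : Fin m} (t : VarT w₀ i₀ j₀ → k) (q : RowT m n w₀ j₀)
    (p : Fin m × Fin m × Fin n) :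
    eval t (kapTU k w₀ i₀ j₀ q p) = kapT (xPtT t) (uPtT t) (vPtT t) q p := by
  rw [kapTU, map_kapT]
  congr 1
  · funext w; rw [map_xPtT]; simp
  · funext i; rw [map_uPtT]; simp
  · funext j; rw [map_vPtT]; simp

/-- The rank hypothesis of generic avoidance for the tangency incidence: on each chart the
universal matrix has full row rank `m + (m - 1) + (n - 1) = dim(chart) + 1`. [folklore] -/
private theorem card_varT_add_one_le_rank {w₀ : Fin n} {i₀ j₀ : Fin m} (t : VarT w₀ i₀ j₀ → k) :
    Fintype.card (VarT w₀ i₀ j₀) + 1 ≤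
      (Matrix.of fun q p => eval t (kapTU k w₀ i₀ j₀ q p) : Matrix (RowT m n w₀ j₀) _ k).rank := by
  classical
  have hmat : (Matrix.of fun q p => eval t (kapTU k w₀ i₀ j₀ q p)) =
      Matrix.of (kapT (xPtT t) (uPtT t) (vPtT t)) := by
    ext q p; exact eval_kapTU t q p
  have hsurj := kapT_mulVec_surjective (k := k) (x := xPtT t) (u := uPtT t) (v := vPtT t)
    (w₀ := w₀) (i₀ := i₀) (j₀ := j₀) (by simp [xPtT]) (by simp [uPtT]) (by simp [vPtT])
  rw [hmat, Matrix.rank, LinearMap.range_eq_top.2 hsurj, finrank_top,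
    Module.finrank_fintype_fun_eq_card]
  simp only [Fintype.card_sum, Fintype.card_fin]
  have h2 : Fintype.card {i : Fin m // i ≠ i₀} < m := by
    simpa using Fintype.card_subtype_lt (p := fun i : Fin m => i ≠ i₀) (x := i₀) (by simp)
  omega

variable (k) [IsAlgClosed k]

/-- **Genericity (T): a general pencil is nowhere tangent to the determinant hypersurface.**
There is a non-zero polynomial `Φ_T(c)` such that for `Φ_T(c) ≠ 0` no `x ≠ 0` admits a kernel
pair `uᵀ Y_c(x) = 0`, `Y_c(x) v = 0`, `u, v ≠ 0` with `uᵀ C_w v = 0` for all `w` — by generic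
avoidance on the charts of `ℙ^{n-1} × ℙ^{m-1} × ℙ^{m-1}` (bad parameters linear of codimension
`2m + n - 2 = dim + 1`; Hartshorne's count for the bad hyperplanes). [cite: Hartshorne1977, II Thm. 8.18 (proof)] -/
theorem exists_generic_no_tangency :
    ∃ Φ : MvPolynomial (Fin m × Fin m × Fin n) k, Φ ≠ 0 ∧
      ∀ c : Fin m × Fin m × Fin n → k, eval c Φ ≠ 0 → ∀ x : Fin n → k, x ≠ 0 →
        ∀ u v : Fin m → k, u ≠ 0 → v ≠ 0 → u ᵥ* pencil c x = 0 → pencil c x *ᵥ v = 0 →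
          (∀ w, u ⬝ᵥ (coefMat c w *ᵥ v) = 0) → False := by
  classical
  have hchart : ∀ ch : Fin n × Fin m × Fin m, ∃ h : MvPolynomial (Fin m × Fin m × Fin n) k,
      h ≠ 0 ∧ ∀ c : Fin m × Fin m × Fin n → k, eval c h ≠ 0 →
        ∀ x : Fin n → k, x ch.1 = 1 → ∀ u v : Fin m → k, u ch.2.1 = 1 → v ch.2.2 = 1 →
          u ᵥ* pencil c x = 0 → pencil c x *ᵥ v = 0 → (∀ w, u ⬝ᵥ (coefMat c w *ᵥ v) = 0) →
            False := by
    rintro ⟨w₀, i₀, j₀⟩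
    obtain ⟨h, hh0, hh⟩ := exists_ne_zero_forall_mulVec_ne_zero k (kapTU k w₀ i₀ j₀)
      card_varT_add_one_le_rank
    refine ⟨h, hh0, fun c hc x hx u v hu hv huY hYv hw => ?_⟩
    let t : VarT w₀ i₀ j₀ → k :=
      Sum.elim (fun w => x w.1) (Sum.elim (fun i => u i.1) (fun j => v j.1))
    have hxt : xPtT t = x := by
      funext w
      by_cases hw' : w = w₀
      · subst hw'; simp [xPtT, hx]
      · simp [xPtT, hw', t]
    have hut : uPtT t = u := by
      funext i
      by_cases hi : i = i₀
      · subst hi; simp [uPtT, hu]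
      · simp [uPtT, hi, t]
    have hvt : vPtT t = v := by
      funext j
      by_cases hj : j = j₀
      · subst hj; simp [vPtT, hv]
      · simp [vPtT, hj, t]
    refine hh c hc t ?_
    have hmat : (Matrix.of fun q p => eval t (kapTU k w₀ i₀ j₀ q p)) =
        Matrix.of (kapT (xPtT t) (uPtT t) (vPtT t)) := by
      ext q p; exact eval_kapTU t q p
    rw [hmat, hxt, hut, hvt, of_kapT_mulVec, hYv, huY]
    funext q
    rcases q with i | j | w
    · rfl
    · rfl
    · exact hw w.1
  choose h hh0 hh using hchart
  refine ⟨∏ ch, h ch, Finset.prod_ne_zero_iff.2 fun ch _ => hh0 ch,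
    fun c hc x hx u v hu hv huY hYv hw => ?_⟩
  obtain ⟨w₀, hw₀⟩ : ∃ w, x w ≠ 0 := by
    by_contra hcon; push Not at hcon; exact hx (funext hcon)
  obtain ⟨i₀, hi₀⟩ : ∃ i, u i ≠ 0 := by
    by_contra hcon; push Not at hcon; exact hu (funext hcon)
  obtain ⟨j₀, hj₀⟩ : ∃ j, v j ≠ 0 := by
    by_contra hcon; push Not at hcon; exact hv (funext hcon)
  have hc' : eval c (h (w₀, i₀, j₀)) ≠ 0 := by
    rw [map_prod] at hc
    exact (Finset.prod_ne_zero_iff.1 hc) _ (Finset.mem_univ _)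
  -- rescale to the chart
  set x' : Fin n → k := (x w₀)⁻¹ • x with hx'
  set u' : Fin m → k := (u i₀)⁻¹ • u with hu'
  set v' : Fin m → k := (v j₀)⁻¹ • v with hv'
  have hpencil : pencil c x' = (x w₀)⁻¹ • pencil c x := by
    ext i j
    simp only [pencil_apply, hx', Pi.smul_apply, smul_eq_mul, Matrix.smul_apply, Finset.mul_sum]
    refine Finset.sum_congr rfl fun w _ => ?_
    ring
  refine hh (w₀, i₀, j₀) c hc' x' (by simp [hx', hw₀]) u' v' (by simp [hu', hi₀])
    (by simp [hv', hj₀]) ?_ ?_ ?_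
  · rw [hpencil, hu', Matrix.smul_vecMul, Matrix.vecMul_smul, huY, smul_zero, smul_zero]
  · rw [hpencil, hv', Matrix.smul_mulVec, Matrix.mulVec_smul, hYv, smul_zero, smul_zero]
  · intro w
    rw [hu', hv', Matrix.mulVec_smul, smul_dotProduct, dotProduct_smul, hw w, smul_zero, smul_zero]

end TangencyIncidence

/-! ### Part 1. Heights of homogeneous ideals via cone sections -/

section ConeSection

variable {k : Type u} [Field k] [IsAlgClosed k] {N : ℕ}

/-- Over an algebraically closed field, a prime of `k[X₁, …, X_N]` whose only `k`-point is the
origin is the irrelevant ideal `ker constantCoeff` (Nullstellensatz). [folklore] -/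
private theorem eq_ker_constantCoeff_of_forall_point_eq_zero {Q : Ideal (MvPolynomial (Fin N) k)}
    [Q.IsPrime] (hQ : ∀ x : Fin N → k, (∀ p ∈ Q, eval x p = 0) → x = 0) :
    Q = RingHom.ker (constantCoeff : MvPolynomial (Fin N) k →+* k) := by
  have hmax := Literature.RingTheory.MvPolynomial.isMaximal_ker_constantCoeff (K := k) (σ := Fin N)
  refine (hmax.eq_of_le (Ideal.IsPrime.ne_top inferInstance) ?_).symm
  intro p hp
  rw [RingHom.mem_ker] at hp
  have hQeq : vanishingIdeal k (zeroLocus k Q) = Q := IsPrime.vanishingIdeal_zeroLocus Q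
  rw [← hQeq, mem_vanishingIdeal_iff]
  intro x hx
  have hx0 : x = 0 := hQ x fun q hq => by
    have h := (mem_zeroLocus_iff.1 hx) q hq
    rwa [aeval_eq_eval] at h
  subst hx0
  rw [aeval_zero, hp, map_zero]

/-- **Height of a homogeneous ideal through a cone section.** Let `I = (S)` be generated by
homogeneous polynomials of `k[X₁, …, X_N]` (`k` algebraically closed) and let `G` be finitely
many polynomials without constant term such that the only common zero of `S ∪ G` is the origin.
Then `N ≤ height I + #G` — the affine-cone form of "a projective variety of dimension `≥ #G`
meets the linear subspace `V(G)`" (Hartshorne I Thm. 7.2), proved from the catenary dimension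
formula for affine domains (Matsumura Thm. 5.6, the tree's
`Literature.RingTheory.KrullDimension.ringKrullDim_quotient_add_height`) and Krull's height
theorem (Mathlib `Ideal.height_le_ringKrullDim_quotient_add_encard`). [cite: Hartshorne1977, I Thm. 7.2] -/
theorem natCast_le_height_span_add_card (S : Set (MvPolynomial (Fin N) k))
    (hS : ∀ p ∈ S, ∃ d, p.IsHomogeneous d) (G : Finset (MvPolynomial (Fin N) k))
    (hG : ∀ g ∈ G, constantCoeff g = 0)
    (h0 : ∀ x : Fin N → k, (∀ p ∈ S, eval x p = 0) → (∀ g ∈ G, eval x g = 0) → x = 0) :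
    (N : ℕ∞) ≤ (Ideal.span S).height + G.card := by
  classical
  letI : GradedAlgebra (homogeneousSubmodule (Fin N) k) := MvPolynomial.gradedAlgebra
  set I : Ideal (MvPolynomial (Fin N) k) := Ideal.span S with hIdef
  set 𝔪₀ : Ideal (MvPolynomial (Fin N) k) :=
    RingHom.ker (constantCoeff : MvPolynomial (Fin N) k →+* k) with h𝔪₀
  have hIhom : I.IsHomogeneous (homogeneousSubmodule (Fin N) k) := by
    refine Ideal.homogeneous_span (𝒜 := homogeneousSubmodule (Fin N) k) _ fun p hp => ?_
    obtain ⟨d, hd⟩ := hS p hp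
    exact ⟨d, (mem_homogeneousSubmodule d p).2 hd⟩
  -- reduce to a minimal prime `P` of `I`
  suffices hP : ∀ P ∈ I.minimalPrimes, (N : ℕ∞) ≤ P.height + G.card by
    rw [Ideal.height_eq_inf_minimalPrimes]
    have h1 : (N : ℕ∞) - G.card ≤ ⨅ J ∈ I.minimalPrimes, J.height :=
      le_iInf₂ fun J hJ => tsub_le_iff_right.2 (hP J hJ)
    exact tsub_le_iff_right.1 h1
  intro P hPmin
  haveI hPprime : P.IsPrime := hPmin.1.1
  have hIP : I ≤ P := hPmin.1.2
  -- `P` is homogeneous, hence inside the irrelevant ideal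
  have hPhom := Literature.RingTheory.MvPolynomial.isHomogeneous_of_mem_minimalPrimes hIhom hPmin
  have hP𝔪₀ : P ≤ 𝔪₀ :=
    Literature.RingTheory.MvPolynomial.le_ker_constantCoeff_of_isHomogeneous hPhom hPprime.ne_top
  have hG𝔪₀ : ∀ g ∈ G, g ∈ 𝔪₀ := fun g hg => by rw [h𝔪₀, RingHom.mem_ker]; exact hG g hg
  have h𝔪₀max : 𝔪₀.IsMaximal := Literature.RingTheory.MvPolynomial.isMaximal_ker_constantCoeff
  -- the affine domain `k[X]/P` and its maximal ideal `𝔫 = 𝔪₀/P`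
  haveI : IsDomain (MvPolynomial (Fin N) k ⧸ P) := Ideal.Quotient.isDomain P
  haveI : Algebra.FiniteType k (MvPolynomial (Fin N) k ⧸ P) :=
    (inferInstance : Algebra.FiniteType k (MvPolynomial (Fin N) k)).of_surjective
      (Ideal.Quotient.mkₐ k P) Ideal.Quotient.mk_surjective
  set 𝔫 : Ideal (MvPolynomial (Fin N) k ⧸ P) := 𝔪₀.map (Ideal.Quotient.mk P) with h𝔫
  have hcomap𝔫 : 𝔫.comap (Ideal.Quotient.mk P) = 𝔪₀ := by
    rw [h𝔫, Ideal.comap_map_of_surjective _ Ideal.Quotient.mk_surjective,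
      ← RingHom.ker_eq_comap_bot, Ideal.mk_ker, sup_eq_left.2 hP𝔪₀]
  haveI h𝔫max : 𝔫.IsMaximal := by
    refine (Ideal.map_eq_top_or_isMaximal_of_surjective _ Ideal.Quotient.mk_surjective
      h𝔪₀max).resolve_left fun htop => h𝔪₀max.ne_top ?_
    rw [← hcomap𝔫, show 𝔫 = ⊤ from htop, Ideal.comap_top]
  -- `dim k[X]/P + height P = N` and `height 𝔫 = dim k[X]/P` (catenary)
  have hcatP := Literature.RingTheory.KrullDimension.ringKrullDim_quotient_add_height (F := k) P
  rw [MvPolynomial.ringKrullDim_of_isNoetherianRing, ringKrullDim_eq_zero_of_field k, zero_add,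
    Nat.card_eq_fintype_card, Fintype.card_fin] at hcatP
  have hcat𝔫 := Literature.RingTheory.KrullDimension.ringKrullDim_quotient_add_height (F := k) 𝔫
  have hfield : ringKrullDim ((MvPolynomial (Fin N) k ⧸ P) ⧸ 𝔫) = 0 := by
    letI := Ideal.Quotient.field 𝔫
    exact ringKrullDim_eq_zero_of_field _
  rw [hfield, zero_add] at hcat𝔫
  -- Krull's height theorem for `𝔫 ⊇ (G mod P)`
  set Gbar : Set (MvPolynomial (Fin N) k ⧸ P) :=
    (Ideal.Quotient.mk P) '' (G : Set (MvPolynomial (Fin N) k)) with hGbar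
  have hGbar𝔫 : Gbar ⊆ 𝔫 := by
    rintro _ ⟨g, hg, rfl⟩
    exact Ideal.mem_map_of_mem _ (hG𝔪₀ g hg)
  have hKrull := Ideal.height_le_ringKrullDim_quotient_add_encard (p := 𝔫) Gbar hGbar𝔫
  -- the quotient `(k[X]/P)/(Gbar) ≅ k[X]/(P ⊔ span G)` has dimension `≤ 0`
  have hspan : Ideal.span Gbar = (Ideal.span (G : Set (MvPolynomial (Fin N) k))).map
      (Ideal.Quotient.mk P) := by
    rw [hGbar, Ideal.map_span]
  have hdim0 : ringKrullDim ((MvPolynomial (Fin N) k ⧸ P) ⧸ Ideal.span Gbar) ≤ 0 := by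
    rw [hspan, ringKrullDim_eq_of_ringEquiv (DoubleQuot.quotQuotEquivQuotSup P
      (Ideal.span (G : Set (MvPolynomial (Fin N) k)))), ringKrullDim_quotient]
    set PG : Ideal (MvPolynomial (Fin N) k) := P ⊔ Ideal.span (G : Set (MvPolynomial (Fin N) k))
      with hPG
    have key : ∀ Q : PrimeSpectrum (MvPolynomial (Fin N) k),
        Q ∈ PrimeSpectrum.zeroLocus (PG : Set (MvPolynomial (Fin N) k)) → Q.asIdeal = 𝔪₀ := by
      intro Q hQ
      have hle : PG ≤ Q.asIdeal := by
        rw [PrimeSpectrum.mem_zeroLocus, SetLike.coe_subset_coe] at hQ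
        exact hQ
      haveI := Q.isPrime
      refine eq_ker_constantCoeff_of_forall_point_eq_zero fun x hx => h0 x ?_ ?_
      · intro p hp
        exact hx p (hle (Ideal.mem_sup_left (hIP (Ideal.subset_span hp))))
      · intro g hg
        exact hx g (hle (Ideal.mem_sup_right (Ideal.subset_span (Finset.mem_coe.2 hg))))
    haveI : Subsingleton (PrimeSpectrum.zeroLocus (PG : Set (MvPolynomial (Fin N) k))) :=
      ⟨fun Q₁ Q₂ => Subtype.ext (PrimeSpectrum.ext ((key Q₁.1 Q₁.2).trans (key Q₂.1 Q₂.2).symm))⟩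
    exact Order.krullDim_nonpos_of_subsingleton
  -- `encard Gbar ≤ #G`
  have hcard : Gbar.encard ≤ (G.card : ℕ∞) := by
    rw [hGbar]
    refine (Set.encard_image_le _ _).trans ?_
    rw [Set.encard_coe_eq_coe_finsetCard]
  -- assemble
  have h1 : ((𝔫.height : ℕ∞) : WithBot ℕ∞) ≤ ((G.card : ℕ∞) : WithBot ℕ∞) := by
    refine hKrull.trans ?_
    calc ringKrullDim ((MvPolynomial (Fin N) k ⧸ P) ⧸ Ideal.span Gbar) + (Gbar.encard : WithBot ℕ∞)
        ≤ (0 : WithBot ℕ∞) + ((G.card : ℕ∞) : WithBot ℕ∞) :=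
          add_le_add hdim0 (by exact_mod_cast hcard)
      _ = ((G.card : ℕ∞) : WithBot ℕ∞) := zero_add _
  have h2 : 𝔫.height ≤ (G.card : ℕ∞) := by exact_mod_cast h1
  have h3 : (((𝔫.height + P.height : ℕ∞)) : WithBot ℕ∞) = ((N : ℕ∞) : WithBot ℕ∞) := by
    rw [WithBot.coe_add, hcat𝔫]
    exact_mod_cast hcatP
  have h4 : 𝔫.height + P.height = N := by exact_mod_cast h3
  calc (N : ℕ∞) = 𝔫.height + P.height := h4.symm
    _ ≤ (G.card : ℕ∞) + P.height := by gcongr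
    _ = P.height + G.card := add_comm _ _

end ConeSection

/-! ### Part 6. Generic pencils have an isolated singular vertex (`n ≤ 4`) -/

section Assembly

variable (k : Type u) [Field k] [IsAlgClosed k] {m n : ℕ}

/-- **Bertini for determinantal pencils, `n ≤ 4`.** There is a non-zero polynomial `Φ(c)` in
the coefficients of the pencil `Y_c(x) = Σ_w x_w C_w` of `m × m` matrices (`m ≥ 2`, `n ≤ 4`)
such that for `Φ(c) ≠ 0` the affine cone `det Y_c(x) = 0` is singular only at the origin:
`det Y_c(x) = 0` and `tr(adj Y_c(x) · C_w) = 0` for all `w` force `x = 0` (ABV Thm. 1.7, first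
bullet: "if `n ≤ 4` then `V(f)` is nonsingular for a general linear map `L`").
[cite: AlperBogartVelasco2017, Thm. 1.7] -/
theorem exists_generic_sing_eq_zero (hn : n ≤ 4) (hm : 2 ≤ m) :
    ∃ Φ : MvPolynomial (Fin m × Fin m × Fin n) k, Φ ≠ 0 ∧
      ∀ c : Fin m × Fin m × Fin n → k, eval c Φ ≠ 0 → ∀ x : Fin n → k,
        (pencil c x).det = 0 → (∀ w, ((pencil c x).adjugate * coefMat c w).trace = 0) → x = 0 := by
  obtain ⟨ΦS, hΦS0, hS⟩ := exists_generic_no_rankDrop k (m := m) hn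
  obtain ⟨ΦT, hΦT0, hT⟩ := exists_generic_no_tangency k (m := m) (n := n)
  refine ⟨ΦS * ΦT, mul_ne_zero hΦS0 hΦT0, fun c hc x hdet htr => ?_⟩
  rw [map_mul] at hc
  have hcS : eval c ΦS ≠ 0 := left_ne_zero_of_mul hc
  have hcT : eval c ΦT ≠ 0 := right_ne_zero_of_mul hc
  by_contra hx
  rcases singular_point_cases hm hdet (coefMat c) htr with
    ⟨j₁, j₂, hj, v₁, v₂, h₁₁, h₁₂, h₂₁, h₂₂, hv₁, hv₂⟩ | ⟨u, v, hu, hv, huY, hYv, hw⟩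
  · exact hS c hcS x hx j₁ j₂ hj v₁ v₂ h₁₁ h₁₂ h₂₁ h₂₂ hv₁ hv₂
  · exact hT c hcT x hx u v hu hv huY hYv hw

end Assembly

/-! ### Part 7. The discharge of `alperBogartVelasco2017_thm_1_7_general` -/

section Discharge

/-- **ABV Thm. 1.7, the equality clause (Bertini) — DISCHARGED.** For an algebraically closed
field `k`, `m ≥ 2` and every `n` there is a non-zero polynomial `Φ` in the `m²n` coefficients of
a linear map `L : kⁿ → k^{m×m}` such that `codim Sing(det_m ∘ L) = min(4, n)` whenever
`Φ(L) ≠ 0` (height form, `codim Sing(f) = height (f, ∂f)` as in `ABV17SingularLocusBound`).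
Proof: `≤` is `alperBogartVelasco2017_thm_1_7_le` (Eagon–Northcott); for `≥`, restrict to the
first `n₀ = min(n, 4)` coordinates, where the generic cone is singular only at its vertex
(`exists_generic_sing_eq_zero`: Hartshorne's dimension count II.8.18 run through the tree's
generic avoidance on the tangency and rank-drop incidences), and conclude by the cone-section
height bound `natCast_le_height_span_add_card` (catenary dimension formula + Krull's height
theorem). The printed proof (p0005.txt:L43–L57) applies Bertini's theorem `m² - n` times to
hyperplane sections of `Det_m ∖ Sing(Det_m)` (Harris, GTM 133, 17.16); the argument here is the
same dimension count organised in one step, and does not use `char k = 0`.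
[cite: AlperBogartVelasco2017, Thm. 1.7] [cite: Hartshorne1977, II Thm. 8.18 (proof)] -/
theorem _root_.Literature.Computability.AlgebraicComplexity.alperBogartVelasco2017_thm_1_7_general_holds :
    alperBogartVelasco2017_thm_1_7_general := by
  intro K _ _ _ n m hm
  classical
  set n₀ := min n 4 with hn₀
  have hn₀4 : n₀ ≤ 4 := min_le_right _ _
  have hn₀n : n₀ ≤ n := min_le_left _ _
  obtain ⟨Φ₀, hΦ₀, hgen⟩ := exists_generic_sing_eq_zero K hn₀4 hm
  -- restriction of the coefficient tensor to the first `n₀` coordinates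
  let ι₀ : Fin n₀ → Fin n := Fin.castLE hn₀n
  have hι₀ : Function.Injective ι₀ := Fin.castLE_injective hn₀n
  let emb : Fin m × Fin m × Fin n₀ → Fin m × Fin m × Fin n := fun p => (p.1, p.2.1, ι₀ p.2.2)
  have hemb : Function.Injective emb := by
    rintro ⟨i, j, w⟩ ⟨i', j', w'⟩ h
    simp only [emb, Prod.mk.injEq] at h
    obtain ⟨rfl, rfl, hw⟩ := h
    rw [hι₀ hw]
  refine ⟨rename emb Φ₀, (map_ne_zero_iff _ (rename_injective emb hemb)).2 hΦ₀, fun c hc => ?_⟩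
  set c₀ : Fin m × Fin m × Fin n₀ → K := fun p => c (emb p) with hc₀
  have hc₀gen : eval c₀ Φ₀ ≠ 0 := by rwa [eval_rename] at hc
  change (singIdeal (linMat c).det).height = min 4 (n : ℕ∞)
  apply le_antisymm
  · -- `≤ min(4, n)`: Eagon–Northcott (ABV17SingularLocusBound)
    simpa [Fintype.card_fin] using
      alperBogartVelasco2017_thm_1_7_le hm (linMat c) (linMat_isHomogeneous c)
  · -- `≥ min(4, n)`: restrict to `n₀` coordinates and bound the height of the cone section
    have hmin : min (4 : ℕ∞) (n : ℕ∞) = (n₀ : ℕ∞) := by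
      rcases le_total n 4 with h | h
      · rw [hn₀, min_eq_left h, min_eq_right (by exact_mod_cast h)]
      · rw [hn₀, min_eq_right h, min_eq_left (by exact_mod_cast h)]
        norm_num
    rw [hmin]
    set f : MvPolynomial (Fin n) K := (linMat c).det with hf
    -- the coordinates outside the image of `ι₀` and the corresponding variables
    set Wout : Finset (Fin n) := (Finset.univ.image ι₀)ᶜ with hWout
    set G : Finset (MvPolynomial (Fin n) K) :=
      Wout.image (fun w => (X w : MvPolynomial (Fin n) K)) with hG
    have hWcard : Wout.card = n - n₀ := by
      rw [hWout, Finset.card_compl, Finset.card_image_of_injective _ hι₀, Finset.card_univ,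
        Fintype.card_fin, Fintype.card_fin]
    have hGcard : G.card ≤ n - n₀ := by
      rw [← hWcard]; exact Finset.card_image_le
    -- homogeneity of the generators of the singular ideal
    have hfhom : f.IsHomogeneous m := by
      simpa [Fintype.card_fin] using
        AlperBogartVelasco.isHomogeneous_det_of_linear (linMat c) (linMat_isHomogeneous c)
    have hS : ∀ p ∈ insert f (Set.range fun i : Fin n => pderiv i f), ∃ d, p.IsHomogeneous d := by
      intro p hp
      rcases Set.mem_insert_iff.1 hp with rfl | ⟨i, rfl⟩
      · exact ⟨m, hfhom⟩
      · exact ⟨m - 1, hfhom.pderiv⟩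
    have hGc : ∀ g ∈ G, constantCoeff g = 0 := by
      intro g hg
      obtain ⟨w, -, rfl⟩ := Finset.mem_image.1 hg
      exact constantCoeff_X K w
    -- the geometric input: common zeros of `singIdeal f` inside the coordinate `n₀`-plane vanish
    have h0 : ∀ x : Fin n → K, (∀ p ∈ insert f (Set.range fun i : Fin n => pderiv i f),
        eval x p = 0) → (∀ g ∈ G, eval x g = 0) → x = 0 := by
      intro x hS0 hG0
      have hxout : ∀ w, w ∉ Finset.univ.image ι₀ → x w = 0 := fun w hw => by
        have h := hG0 (X w) (Finset.mem_image_of_mem _ (by rw [hWout, Finset.mem_compl]; exact hw))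
        simpa using h
      set x₀ : Fin n₀ → K := fun w => x (ι₀ w) with hx₀
      have hpencil : pencil c x = pencil c₀ x₀ := by
        ext i j
        simp only [pencil_apply, hc₀, hx₀, emb]
        rw [← Finset.sum_image (f := fun w => c (i, j, w) * x w)
          (s := (Finset.univ : Finset (Fin n₀))) (g := ι₀) (fun a _ b _ h => hι₀ h)]
        refine (Finset.sum_subset (Finset.subset_univ _) fun w _ hw => ?_).symm
        rw [hxout w hw, mul_zero]
      have hdet : (pencil c₀ x₀).det = 0 := by
        rw [← hpencil, ← eval_det_linMat]
        exact hS0 _ (Set.mem_insert _ _)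
      have htr : ∀ w', ((pencil c₀ x₀).adjugate * coefMat c₀ w').trace = 0 := by
        intro w'
        have h := hS0 (pderiv (ι₀ w') f) (Set.mem_insert_of_mem _ ⟨ι₀ w', rfl⟩)
        rw [hf, eval_pderiv_det_linMat, hpencil] at h
        have hcoef : coefMat c (ι₀ w') = coefMat c₀ w' := by ext i j; rfl
        rwa [hcoef] at h
      have hx₀0 : x₀ = 0 := hgen c₀ hc₀gen x₀ hdet htr
      funext w
      by_cases hw : w ∈ Finset.univ.image ι₀
      · obtain ⟨w', -, rfl⟩ := Finset.mem_image.1 hw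
        have h := congrFun hx₀0 w'
        simpa [hx₀] using h
      · exact hxout w hw
    -- the height bound
    have key := natCast_le_height_span_add_card _ hS G hGc h0
    change (n : ℕ∞) ≤ (singIdeal f).height + G.card at key
    rcases eq_or_ne (singIdeal f).height ⊤ with htop | hne
    · rw [htop]; exact le_top
    · obtain ⟨a, ha⟩ := ENat.ne_top_iff_exists.1 hne
      rw [← ha] at key ⊢
      have h1 : n ≤ a + G.card := by exact_mod_cast key
      exact_mod_cast (show n₀ ≤ a by omega)

end Discharge

end ABV17Bertini

end Literature.Computability.AlgebraicComplexity
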